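import Mathlib
import Summits.Ventures.PercRepro2.Defs
import Summits.Ventures.PercRepro2.Harris
import Summits.Ventures.PercRepro2.Graph
import Summits.Ventures.PercRepro2.Events

/-!
# The class-(v) graph plus the edge `r–h`: its root cluster in Boolean reachability formulas
(mine-a g50)

`G₅⁺` is the class-(v) graph `G₅` of `THClassVGraph` (root `r = 0`, hit vertex `h = 1`, edges
`r–x₂, …, r–x₆, h–x₂, h–x₃, x₂–x₄, x₂–x₅, x₃–x₆` = edges `0, …, 9`) with the extra edge `r–h`
(edge `10`).  The cluster of the root is the explicit Boolean set `inC` (`cluster_eq`): the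
reachability formulas of `G₅` with the hit vertex reached also directly (`hc = … ∨ rh`).  The
events of the tight pair `(𝓤, 𝓥) = ({x₆ ∈ T}, {x₄, x₅ ∈ T})` — `Q = {h ∈ C_r}`, `U = {x₆ ∈ C_r}`,
`e = {x₄, x₅ ∈ C_r}` — are decided by `inC`.  On `G₅⁺` the main antipodal base case is `1`, but the
proper pinned case «`r–h` closed» is `G₅`'s `−2`: the instance of the relative (signomial)
certificate `THSignomialCert` (`THClassVPlus`).  No instance, no notation.
-/

namespace Summit.Ventures.PercRepro2

namespace THClassVPlus

open Finset

/-- The edge map of `G₅⁺`: `r–x₂, r–x₃, r–x₄, r–x₅, r–x₆, h–x₂, h–x₃, x₂–x₄, x₂–x₅, x₃–x₆, r–h`. -/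
def ends : Fin 11 → Sym2 (Fin 7) :=
  ![s(0, 2), s(0, 3), s(0, 4), s(0, 5), s(0, 6), s(1, 2), s(1, 3), s(2, 4), s(2, 5), s(3, 6),
    s(0, 1)]

section Reach

/-- Reachability of `x₂` from the root avoiding `h` (`l2`, `l4 ∧ a`, `l5 ∧ b`). -/
def r2 (l2 l4 l5 a b : Bool) : Bool := l2 || (l4 && a) || (l5 && b)

/-- Reachability of `x₄` from the root avoiding `h`. -/
def r4 (l2 l4 l5 a b : Bool) : Bool := l4 || (a && (l2 || (l5 && b)))

/-- Reachability of `x₅` from the root avoiding `h`. -/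
def r5 (l2 l4 l5 a b : Bool) : Bool := l5 || (b && (l2 || (l4 && a)))

/-- Reachability of `x₃` from the root avoiding `h`. -/
def r3 (l3 l6 c : Bool) : Bool := l3 || (l6 && c)

/-- Reachability of `x₆` from the root avoiding `h`. -/
def r6 (l3 l6 c : Bool) : Bool := l6 || (l3 && c)

/-- Reachability of the hit vertex: through `x₂`, through `x₃`, or directly. -/
def hc (l2 l3 l4 l5 l6 h2 h3 a b c rh : Bool) : Bool :=
  (r2 l2 l4 l5 a b && h2) || (r3 l3 l6 c && h3) || rh

/-- The Boolean membership of every vertex in the cluster of the root, as a function of the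
eleven edge states `l2 l3 l4 l5 l6 h2 h3 a b c rh`. -/
def inCf (l2 l3 l4 l5 l6 h2 h3 a b c rh : Bool) : Fin 7 → Bool :=
  ![true, hc l2 l3 l4 l5 l6 h2 h3 a b c rh,
    r2 l2 l4 l5 a b || (hc l2 l3 l4 l5 l6 h2 h3 a b c rh && h2),
    r3 l3 l6 c || (hc l2 l3 l4 l5 l6 h2 h3 a b c rh && h3),
    r4 l2 l4 l5 a b || (hc l2 l3 l4 l5 l6 h2 h3 a b c rh && h2 && a),
    r5 l2 l4 l5 a b || (hc l2 l3 l4 l5 l6 h2 h3 a b c rh && h2 && b),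
    r6 l3 l6 c || (hc l2 l3 l4 l5 l6 h2 h3 a b c rh && h3 && c)]

/-- Membership in the cluster of the root at a configuration. -/
def inC (ω : Config (Fin 11)) (v : Fin 7) : Bool :=
  inCf (ω 0) (ω 1) (ω 2) (ω 3) (ω 4) (ω 5) (ω 6) (ω 7) (ω 8) (ω 9) (ω 10) v

/-- The explicit cluster set. -/
def clusterSet (ω : Config (Fin 11)) : Set (Fin 7) := {v | inC ω v = true}

/-- **Closure of the explicit set along every edge, in both directions** (a Boolean tautology in
the ten edge variables, checked by `decide`). -/
lemma closed_tauto : ∀ l2 l3 l4 l5 l6 h2 h3 a b c rh : Bool,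
    let f := inCf l2 l3 l4 l5 l6 h2 h3 a b c rh
    (l2 = true → f 2 = true) ∧ (l3 = true → f 3 = true) ∧ (l4 = true → f 4 = true) ∧
    (l5 = true → f 5 = true) ∧ (l6 = true → f 6 = true) ∧
    (h2 = true → f 1 = true → f 2 = true) ∧ (h2 = true → f 2 = true → f 1 = true) ∧
    (h3 = true → f 1 = true → f 3 = true) ∧ (h3 = true → f 3 = true → f 1 = true) ∧
    (a = true → f 2 = true → f 4 = true) ∧ (a = true → f 4 = true → f 2 = true) ∧
    (b = true → f 2 = true → f 5 = true) ∧ (b = true → f 5 = true → f 2 = true) ∧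
    (c = true → f 3 = true → f 6 = true) ∧ (c = true → f 6 = true → f 3 = true) := by
  intro l2 l3 l4 l5 l6 h2 h3 a b c rh
  revert l2 l3 l4 l5 l6 h2 h3 a b c
  cases rh <;> decide

/-- The explicit set is closed under open adjacency. -/
lemma clusterSet_closed (ω : Config (Fin 11)) :
    ∀ x ∈ clusterSet ω, ∀ y, (openGraph ends ω).Adj x y → y ∈ clusterSet ω := by
  intro x hx y hxy
  obtain ⟨-, e, he, hends⟩ := openGraph_adj.1 hxy
  have ht := closed_tauto (ω 0) (ω 1) (ω 2) (ω 3) (ω 4) (ω 5) (ω 6) (ω 7) (ω 8) (ω 9) (ω 10)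
  simp only [clusterSet, Set.mem_setOf_eq, inC] at hx ⊢
  fin_cases e <;> simp only [ends, Fin.isValue] at hends he <;>
    rcases Sym2.eq_iff.1 hends with ⟨rfl, rfl⟩ | ⟨rfl, rfl⟩
  all_goals first
    | exact (ht.1 he) | exact (ht.2.1 he) | exact (ht.2.2.1 he) | exact (ht.2.2.2.1 he)
    | exact (ht.2.2.2.2.1 he) | exact (ht.2.2.2.2.2.1 he hx) | exact (ht.2.2.2.2.2.2.1 he hx)
    | exact (ht.2.2.2.2.2.2.2.1 he hx) | exact (ht.2.2.2.2.2.2.2.2.1 he hx)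
    | exact (ht.2.2.2.2.2.2.2.2.2.1 he hx) | exact (ht.2.2.2.2.2.2.2.2.2.2.1 he hx)
    | exact (ht.2.2.2.2.2.2.2.2.2.2.2.1 he hx) | exact (ht.2.2.2.2.2.2.2.2.2.2.2.2.1 he hx)
    | exact (ht.2.2.2.2.2.2.2.2.2.2.2.2.2.1 he hx) | exact (ht.2.2.2.2.2.2.2.2.2.2.2.2.2.2 he hx)
    | rfl
    | (show hc (ω 0) (ω 1) (ω 2) (ω 3) (ω 4) (ω 5) (ω 6) (ω 7) (ω 8) (ω 9) (ω 10) = true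
       unfold hc
       exact (Bool.or_eq_true _ _).mpr (Or.inr he))

/-- Connections along single open edges (the ten edges, both ends). -/
lemma conn_edge (ω : Config (Fin 11)) (i : Fin 11) (u v : Fin 7) (h : ω i = true)
    (hi : ends i = s(u, v)) : Conn ends ω u v := conn_of_openAdj ⟨i, h, hi⟩

/-- `r2` gives a connection `r ↔ x₂` (without `h`). -/
lemma conn_of_r2 (ω : Config (Fin 11)) (h : r2 (ω 0) (ω 2) (ω 3) (ω 7) (ω 8) = true) :
    Conn ends ω 0 2 := by
  unfold r2 at h
  simp only [Bool.or_eq_true, Bool.and_eq_true] at h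
  rcases h with (h0 | ⟨h2, h7⟩) | ⟨h3, h8⟩
  · exact conn_edge ω 0 0 2 h0 rfl
  · exact conn_trans (conn_edge ω 2 0 4 h2 rfl) (conn_symm (conn_edge ω 7 2 4 h7 rfl))
  · exact conn_trans (conn_edge ω 3 0 5 h3 rfl) (conn_symm (conn_edge ω 8 2 5 h8 rfl))

/-- `r4` gives a connection `r ↔ x₄`. -/
lemma conn_of_r4 (ω : Config (Fin 11)) (h : r4 (ω 0) (ω 2) (ω 3) (ω 7) (ω 8) = true) :
    Conn ends ω 0 4 := by
  unfold r4 at h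
  simp only [Bool.or_eq_true, Bool.and_eq_true] at h
  rcases h with h2 | ⟨h7, h0 | ⟨h3, h8⟩⟩
  · exact conn_edge ω 2 0 4 h2 rfl
  · exact conn_trans (conn_edge ω 0 0 2 h0 rfl) (conn_edge ω 7 2 4 h7 rfl)
  · exact conn_trans (conn_trans (conn_edge ω 3 0 5 h3 rfl) (conn_symm (conn_edge ω 8 2 5 h8 rfl)))
      (conn_edge ω 7 2 4 h7 rfl)

/-- `r5` gives a connection `r ↔ x₅`. -/
lemma conn_of_r5 (ω : Config (Fin 11)) (h : r5 (ω 0) (ω 2) (ω 3) (ω 7) (ω 8) = true) :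
    Conn ends ω 0 5 := by
  unfold r5 at h
  simp only [Bool.or_eq_true, Bool.and_eq_true] at h
  rcases h with h3 | ⟨h8, h0 | ⟨h2, h7⟩⟩
  · exact conn_edge ω 3 0 5 h3 rfl
  · exact conn_trans (conn_edge ω 0 0 2 h0 rfl) (conn_edge ω 8 2 5 h8 rfl)
  · exact conn_trans (conn_trans (conn_edge ω 2 0 4 h2 rfl) (conn_symm (conn_edge ω 7 2 4 h7 rfl)))
      (conn_edge ω 8 2 5 h8 rfl)

/-- `r3` gives a connection `r ↔ x₃`. -/
lemma conn_of_r3 (ω : Config (Fin 11)) (h : r3 (ω 1) (ω 4) (ω 9) = true) : Conn ends ω 0 3 := by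
  unfold r3 at h
  simp only [Bool.or_eq_true, Bool.and_eq_true] at h
  rcases h with h1 | ⟨h4, h9⟩
  · exact conn_edge ω 1 0 3 h1 rfl
  · exact conn_trans (conn_edge ω 4 0 6 h4 rfl) (conn_symm (conn_edge ω 9 3 6 h9 rfl))

/-- `r6` gives a connection `r ↔ x₆`. -/
lemma conn_of_r6 (ω : Config (Fin 11)) (h : r6 (ω 1) (ω 4) (ω 9) = true) : Conn ends ω 0 6 := by
  unfold r6 at h
  simp only [Bool.or_eq_true, Bool.and_eq_true] at h
  rcases h with h4 | ⟨h1, h9⟩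
  · exact conn_edge ω 4 0 6 h4 rfl
  · exact conn_trans (conn_edge ω 1 0 3 h1 rfl) (conn_edge ω 9 3 6 h9 rfl)

/-- `hc` gives a connection `r ↔ h`. -/
lemma conn_of_hc (ω : Config (Fin 11))
    (h : hc (ω 0) (ω 1) (ω 2) (ω 3) (ω 4) (ω 5) (ω 6) (ω 7) (ω 8) (ω 9) (ω 10) = true) :
    Conn ends ω 0 1 := by
  unfold hc at h
  simp only [Bool.or_eq_true, Bool.and_eq_true] at h
  rcases h with (⟨hr, h5⟩ | ⟨hr, h6⟩) | h10
  · exact conn_trans (conn_of_r2 ω hr) (conn_symm (conn_edge ω 5 1 2 h5 rfl))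
  · exact conn_trans (conn_of_r3 ω hr) (conn_symm (conn_edge ω 6 1 3 h6 rfl))
  · exact conn_edge ω 10 0 1 h10 rfl

/-- Every vertex of the explicit set is connected to the root. -/
lemma conn_of_inC (ω : Config (Fin 11)) (v : Fin 7) (h : inC ω v = true) : Conn ends ω 0 v := by
  fin_cases v
  · exact conn_refl ends ω 0
  · exact conn_of_hc ω h
  · change (r2 (ω 0) (ω 2) (ω 3) (ω 7) (ω 8)
      || (hc (ω 0) (ω 1) (ω 2) (ω 3) (ω 4) (ω 5) (ω 6) (ω 7) (ω 8) (ω 9) (ω 10) && ω 5)) = true at h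
    simp only [Bool.or_eq_true, Bool.and_eq_true] at h
    rcases h with hr | ⟨hh, h5⟩
    · exact conn_of_r2 ω hr
    · exact conn_trans (conn_of_hc ω hh) (conn_edge ω 5 1 2 h5 rfl)
  · change (r3 (ω 1) (ω 4) (ω 9)
      || (hc (ω 0) (ω 1) (ω 2) (ω 3) (ω 4) (ω 5) (ω 6) (ω 7) (ω 8) (ω 9) (ω 10) && ω 6)) = true at h
    simp only [Bool.or_eq_true, Bool.and_eq_true] at h
    rcases h with hr | ⟨hh, h6⟩
    · exact conn_of_r3 ω hr
    · exact conn_trans (conn_of_hc ω hh) (conn_edge ω 6 1 3 h6 rfl)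
  · change (r4 (ω 0) (ω 2) (ω 3) (ω 7) (ω 8)
      || (hc (ω 0) (ω 1) (ω 2) (ω 3) (ω 4) (ω 5) (ω 6) (ω 7) (ω 8) (ω 9) (ω 10) && ω 5 && ω 7)) = true at h
    simp only [Bool.or_eq_true, Bool.and_eq_true] at h
    rcases h with hr | ⟨⟨hh, h5⟩, h7⟩
    · exact conn_of_r4 ω hr
    · exact conn_trans (conn_trans (conn_of_hc ω hh) (conn_edge ω 5 1 2 h5 rfl))
        (conn_edge ω 7 2 4 h7 rfl)
  · change (r5 (ω 0) (ω 2) (ω 3) (ω 7) (ω 8)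
      || (hc (ω 0) (ω 1) (ω 2) (ω 3) (ω 4) (ω 5) (ω 6) (ω 7) (ω 8) (ω 9) (ω 10) && ω 5 && ω 8)) = true at h
    simp only [Bool.or_eq_true, Bool.and_eq_true] at h
    rcases h with hr | ⟨⟨hh, h5⟩, h8⟩
    · exact conn_of_r5 ω hr
    · exact conn_trans (conn_trans (conn_of_hc ω hh) (conn_edge ω 5 1 2 h5 rfl))
        (conn_edge ω 8 2 5 h8 rfl)
  · change (r6 (ω 1) (ω 4) (ω 9)
      || (hc (ω 0) (ω 1) (ω 2) (ω 3) (ω 4) (ω 5) (ω 6) (ω 7) (ω 8) (ω 9) (ω 10) && ω 6 && ω 9)) = true at h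
    simp only [Bool.or_eq_true, Bool.and_eq_true] at h
    rcases h with hr | ⟨⟨hh, h6⟩, h9⟩
    · exact conn_of_r6 ω hr
    · exact conn_trans (conn_trans (conn_of_hc ω hh) (conn_edge ω 6 1 3 h6 rfl))
        (conn_edge ω 9 3 6 h9 rfl)

/-- **The cluster of the root of `G₅⁺`** is the explicit set. -/
theorem cluster_eq (ω : Config (Fin 11)) : cluster ends ω 0 = clusterSet ω := by
  apply Set.Subset.antisymm
  · intro v hv
    exact mem_of_conn_of_closed (clusterSet_closed ω) (by simp [clusterSet, inC, inCf]) hv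
  · intro v hv
    exact conn_of_inC ω v hv

/-- Membership of a vertex in the cluster, decided by `inC`. -/
lemma mem_cluster_iff (ω : Config (Fin 11)) (v : Fin 7) :
    v ∈ cluster ends ω 0 ↔ inC ω v = true := by
  rw [cluster_eq]; rfl

end Reach

section Events

/-- The up-set `𝓤 = {x₆ ∈ T}` (`= ↑{r, x₆}` on clusters of the root). -/
def 𝓤 : Set (Set (Fin 7)) := {T | (6 : Fin 7) ∈ T}

/-- The up-set `𝓥 = {x₄, x₅ ∈ T}` (`= ↑{r, x₄, x₅}` on clusters of the root). -/
def 𝓥 : Set (Set (Fin 7)) := {T | (4 : Fin 7) ∈ T ∧ (5 : Fin 7) ∈ T}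

/-- `𝓤` is an up-set. -/
lemma isUpperSet_𝓤 : IsUpperSet 𝓤 := fun _ _ h hT => h hT

/-- `𝓥` is an up-set. -/
lemma isUpperSet_𝓥 : IsUpperSet 𝓥 := fun _ _ h hT => ⟨h hT.1, h hT.2⟩

/-- The hit event `Q = {h ∈ C_r}`. -/
def Q : Set (Config (Fin 11)) := clusterInEvent ends 0 {T : Set (Fin 7) | (1 : Fin 7) ∈ T}

/-- The event `U = {C_r ∈ 𝓤} = {x₆ ∈ C_r}`. -/
def U : Set (Config (Fin 11)) := clusterInEvent ends 0 𝓤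

/-- The event `e = {C_r ∈ 𝓥} = {x₄, x₅ ∈ C_r}`. -/
def e : Set (Config (Fin 11)) := clusterInEvent ends 0 𝓥

/-- `Q` is decided by `inC · 1`. -/
def qB (ω : Config (Fin 11)) : Bool := inC ω 1

/-- `U` is decided by `inC · 6`. -/
def uB (ω : Config (Fin 11)) : Bool := inC ω 6

/-- `e` is decided by `inC · 4 && inC · 5`. -/
def eB (ω : Config (Fin 11)) : Bool := inC ω 4 && inC ω 5

/-- The hit event is decided by `qB`. -/
lemma mem_Q_iff (ω : Config (Fin 11)) : ω ∈ Q ↔ qB ω = true := by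
  rw [Q, mem_clusterInEvent, Set.mem_setOf_eq, mem_cluster_iff]; rfl

/-- `U` is decided by `uB`. -/
lemma mem_U_iff (ω : Config (Fin 11)) : ω ∈ U ↔ uB ω = true := by
  rw [U, mem_clusterInEvent, 𝓤, Set.mem_setOf_eq, mem_cluster_iff]; rfl

/-- `e` is decided by `eB`. -/
lemma mem_e_iff (ω : Config (Fin 11)) : ω ∈ e ↔ eB ω = true := by
  rw [e, mem_clusterInEvent, 𝓥, Set.mem_setOf_eq, mem_cluster_iff, mem_cluster_iff, eB,
    Bool.and_eq_true]

end Events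

end THClassVPlus

end Summit.Ventures.PercRepro2
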